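import Mathlib
import Summits.Ventures.PercRepro2.CutFarOA3Rule

/-!
# The marks `o` and `a₃` behind an unmarked cut vertex, V: the coincidence gadget is free (blind cell
PercRepro2, p3 g3, 2026-08-25; `proofs/P3-BRIDGE.md` §11.14)

The two-gadget rule `typedCount_eq_cutFarOA3` pays the far side with the two root-side gadget bases
`Pa` (`o` pendant at `c` by a type-1 edge, `a₃` absent — the TB14-type instance) and `Pb` (`o` and `a₃`
hung together on one type-1 edge at `c` — the coincidence instance).  **`Pb` is nonnegative
outright**: its orbit kernel `orb1'` — the six-fold symmetrisation of «`o` and `a₃` together in one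
copy» — is `≥ 0` on every valid triple of root-side states (`orb1p_nonneg`, `decide` over the
`13³` valid triples), and `6 · Pb` is the typed count of that kernel (`six_orb1p`).  Hence
row 2′TRI on the class follows from row 2′TRI on the TB14-type instance ALONE
(`typedCount_nonneg_of_cutFarOA3'`).  Own work; standard axioms.
-/

namespace Summit.Ventures.PercRepro2

open UnionCluster

namespace CovForm

namespace RootBridge

open OneTyped TypedA3 Untouched TypedFactor Separated

section Coincidence

open Classical

variable {V : Type*} {E : Type*} [Fintype E] [DecidableEq E] {R : Type*} [Field R]
  [LinearOrder R] [IsStrictOrderedRing R]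
variable (ends : E → Sym2 V) (o a₁ a₂ a₃ b c : V)

/-- **The coincidence orbit kernel is pointwise nonnegative** on valid root-side triples: the
six-fold symmetrisation of the pattern «`o` and `a₃` together in one copy, absent in the other two»
never goes negative (checked on the `13³` valid triples). -/
theorem orb1p_nonneg (rx ry rw : R5) (hx : Valid5' rx = true) (hy : Valid5' ry = true)
    (hw : Valid5' rw = true) : 0 ≤ orb1' rx ry rw := by
  revert rx ry rw
  decide +kernel

/-- **The coincidence gadget base is nonnegative**: `Pb ≥ 0` for every typed root-side instance. -/
theorem Pb_nonneg (VH : Set V) (B : Finset E) (z : Config E) (τ : E → ℕ)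
    (hτ : ∀ e ∈ B, τ e = 1 ∨ τ e = 2) : 0 ≤ Pb (R := R) ends a₁ a₂ b c VH B z τ := by
  have h6 := six_orb1p (R := R) ends a₁ a₂ b c VH B z τ hτ
  have hK : (0 : R) ≤ typedCount B z τ (fun x y w => ((orb1' (rOA ends a₁ a₂ b c VH x)
      (rOA ends a₁ a₂ b c VH y) (rOA ends a₁ a₂ b c VH w) : ℤ) : R)) := by
    refine typedCount_nonneg_of_nonneg _ _ _ fun x y w => ?_
    exact_mod_cast orb1p_nonneg _ _ _ (rOA_valid ends a₁ a₂ b c VH x) (rOA_valid ends a₁ a₂ b c VH y)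
      (rOA_valid ends a₁ a₂ b c VH w)
  have h6' : (0 : R) ≤ 6 * Pb (R := R) ends a₁ a₂ b c VH B z τ := by
    unfold Pb
    rw [h6]
    exact hK
  exact (mul_nonneg_iff_of_pos_left (by norm_num : (0 : R) < 6)).mp h6'

/-- **Row 2′TRI when `o` and `a₃` sit behind an unmarked cut vertex** follows from row 2′TRI on the
TB14-type gadget instance `Pa` alone: the coincidence base `Pb` is free (`Pb_nonneg`). -/
theorem typedCount_nonneg_of_cutFarOA3' {VL VH : Set V} (F : Finset E) (z : Config E) (τ : E → ℕ)
    (hτ : ∀ e ∈ F, τ e = 1 ∨ τ e = 2) (h : CutFarOA3 ends o a₁ a₂ a₃ b c VL VH F z)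
    (ha : 0 ≤ Pa (R := R) ends a₁ a₂ b c VH (sideF ends VH F) z τ) :
    0 ≤ typedCount F z τ (K3 ends o a₁ a₂ a₃ b : Config E → Config E → Config E → R) := by
  have hτB : ∀ e ∈ sideF ends VH F, τ e = 1 ∨ τ e = 2 :=
    fun e he => hτ e (Finset.filter_subset _ _ he)
  exact typedCount_nonneg_of_cutFarOA3 ends o a₁ a₂ a₃ b c F z τ hτ h ha
    (Pb_nonneg ends a₁ a₂ b c VH (sideF ends VH F) z τ hτB)

end Coincidence

end RootBridge

end CovForm

end Summit.Ventures.PercRepro2
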